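import Summits.BirchSwinnertonDyer.BirchSwinnertonDyer.Theses.KimAtThreeKolyvagin
import Summits.BirchSwinnertonDyer.BirchSwinnertonDyer.Theorems.KimAtThreeKolyvaginInputs
import HarnessLib

/-!
# Route `KimAtThreeKolyvagin` (rung W2): the Assembly item

The assembly item `stmt-BirchSwinnertonDyer-19078` of the ledger route
`route-BirchSwinnertonDyer-KimAtThreeKolyvagin` (cell `bsd-addord`, D-0059 / D-0061 rung W2):
`DeepLowerAtThree → DeepUpperAtThree → ShallowEqDeepAtTorsionFree → N11.KimAtThreeRankZeroPUB`.
It is exactly the Theorems-side bridge `KimAtThreeKolyvaginInputs.kimAtThreeRankZeroPUB_of_inputs`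
(p406491), whose three inline hypotheses are the three crux statements verbatim: (L) ∧ (U) give
`∂^{(∞)}_{deep} = d` and `∂⁽⁰⁾ = ord₃ #Ш(3) + d`, and (S) with
`kuriharaPartialInfty_le_kuriharaPartialDeepInfty` gives `∂^{(∞)} = d` (pure `ℕ∞` bookkeeping).
Nothing else is asserted; the three cruxes stay open items (their human proof of record is the cell
memo `run/shared/lean/pub/bsd-addord/kim3/KIM3-PROOF.md`, referee PASS, attached as item evidence).
[cite: Kim2025RefinedTNC, Thm 1.1, Thm 1.2] [cite: MazurRubin2004, Thm 5.2.12]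
-/

-- the Theorems namespace of a single-conjunct summit repeats the summit name by design (D-0017)
set_option linter.dupNamespace false

namespace Summit.BirchSwinnertonDyer.BirchSwinnertonDyer.Theorems

/-- **Assembly of route `KimAtThreeKolyvagin`**: the three cruxes (deep lower / deep upper / shallow =
deep at `E(ℚ₃)[3] = 0`) imply the rung-W2 leaf `N11.KimAtThreeRankZeroPUB`, by the bridge
`KimAtThreeKolyvaginInputs.kimAtThreeRankZeroPUB_of_inputs` (antisymmetry in `ℕ∞`).
[cite: Kim2025RefinedTNC, Thm 1.2] -/
theorem kimAtThreeKolyvagin_assembly_proof :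
    Summit.BirchSwinnertonDyer.BirchSwinnertonDyer.Theses.KimAtThreeKolyvagin.Assembly := by
  intro h₁ h₂ h₃
  exact KimAtThreeKolyvaginInputs.kimAtThreeRankZeroPUB_of_inputs h₁ h₂ h₃

end Summit.BirchSwinnertonDyer.BirchSwinnertonDyer.Theorems
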